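import Summits.CriticalPhenomena.CardyFormulaZ2.Theorems.CardyComplexConeDefs

/-!
# Stub `stub_ipAsymptotic` of line `qkz-strip-boundary-arm`
(crux `EdgePrecompact`, stmt-CriticalPhenomena-11387)

Pure real analysis on Ikhlef–Ponsaing's exact strip passage probability
`ipRatio m = vsasm m * vsasm (m+1) / csscpp (m+1)^2` (IP12 Prop. 4.7): the upper bound
`ipRatio m ≤ C (2m+1)^{-1/3}` (IP12 Prop. 4.9 gives the sharp constant `≈ 1.137`; here `C = 2`).

Proof.
1. One-step ratio (factorial telescoping): `ipRatio (m+1) = ipRatio m * N m / D m` with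
   `N m = (3m+5)(6m+7)(4m+3)`, `D m = (3m+4)(6m+5)(4m+7)` (`ipRatio_succ`).
2. Polynomial identity `D^3 (2m+2) = N^3 (2m+4) + Q(m)` with `Q` a polynomial with non-negative
   coefficients, whence `g m := ipRatio m ^ 3 * (m+1)` is non-increasing; `g 0 = 1`
   (`ipRatio 0 = 1`), so `ipRatio m ^ 3 * (m+1) ≤ 1` (`ipRatio_cube_mul_le_one`).
3. `ipRatio m ^ 3 ≤ 1/(m+1) ≤ 8/(2m+1) = (2 (2m+1)^{-1/3})^3`, and cube roots are monotone.
-/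

namespace Summit.CriticalPhenomena.CardyFormulaZ2.Cruxes.EdgePrecompact.QkzStripBoundaryArm

open scoped BigOperators

/-- One step of the product `vsasm`:
`A_V(2m+3) = A_V(2m+1) · (3m+2)(6m+3)!(2m+1)!/((4m+2)!(4m+3)!)`. -/
private theorem vsasm_succ (m : ℕ) :
    vsasm (m + 1) = vsasm m *
      (((3 * m + 2 : ℕ) * (6 * m + 3).factorial * (2 * m + 1).factorial : ℝ) /
        ((4 * m + 2).factorial * (4 * m + 3).factorial : ℝ)) := by
  unfold vsasm
  rw [Finset.prod_range_succ]

/-- One step of the product `csscpp`: `N_8(2m+2) = N_8(2m) · (3m+1)(6m)!(2m)!/((4m)!(4m+1)!)`. -/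
private theorem csscpp_succ (m : ℕ) :
    csscpp (m + 1) = csscpp m *
      (((3 * m + 1 : ℕ) * (6 * m).factorial * (2 * m).factorial : ℝ) /
        ((4 * m).factorial * (4 * m + 1).factorial : ℝ)) := by
  unfold csscpp
  rw [Finset.prod_range_succ]

/-- `A_V(2m+1) > 0`. -/
private theorem vsasm_pos (m : ℕ) : 0 < vsasm m := by
  unfold vsasm
  exact Finset.prod_pos fun i _ => by positivity

/-- `N_8(2m) > 0`. -/
private theorem csscpp_pos (m : ℕ) : 0 < csscpp m := by
  unfold csscpp
  exact Finset.prod_pos fun i _ => by positivity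

/-- `P_b(2m+1) ≥ 0`. -/
private theorem ipRatio_nonneg (m : ℕ) : 0 ≤ ipRatio m := by
  unfold ipRatio
  have := vsasm_pos m
  have := vsasm_pos (m + 1)
  positivity

/-- `P_b(1) = 1` (`A_V(1) = A_V(3) = N_8(2) = 1`). -/
private theorem ipRatio_zero : ipRatio 0 = 1 := by
  have h0 : vsasm 0 = 1 := by simp [vsasm]
  have h1 : vsasm 1 = 1 := by
    rw [vsasm_succ, h0]
    norm_num [Nat.factorial]
  have h2 : csscpp 1 = 1 := by
    rw [csscpp_succ]
    simp [csscpp, Nat.factorial]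
  simp [ipRatio, h0, h1, h2]

/-- `(n+k)!` telescoped down to `n!`, cast to `ℝ`. -/
private theorem cast_factorial_telescope (t n k : ℕ) (h : t = n + k) :
    (t.factorial : ℝ) = (∏ j ∈ Finset.range k, ((n : ℝ) + j + 1)) * n.factorial := by
  subst h
  induction k with
  | zero => simp
  | succ k ih =>
    rw [Finset.prod_range_succ, show n + (k + 1) = (n + k) + 1 from rfl, Nat.factorial_succ]
    push_cast
    rw [ih]
    ring

/-- One-step ratio of `ipRatio` (factorial telescoping):
`P_b(2m+3) = P_b(2m+1) · (3m+5)(6m+7)(4m+3) / ((3m+4)(6m+5)(4m+7))`. -/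
private theorem ipRatio_succ (m : ℕ) :
    ipRatio (m + 1) = ipRatio m *
      (((3 * m + 5) * (6 * m + 7) * (4 * m + 3) : ℝ) /
        ((3 * m + 4) * (6 * m + 5) * (4 * m + 7))) := by
  have hv : 0 < vsasm m := vsasm_pos m
  have hc : 0 < csscpp (m + 1) := csscpp_pos (m + 1)
  have hF6 : (0 : ℝ) < (6 * m + 3).factorial := by positivity
  have hF2 : (0 : ℝ) < (2 * m + 1).factorial := by positivity
  have hF4 : (0 : ℝ) < (4 * m + 2).factorial := by positivity
  simp only [ipRatio]
  rw [vsasm_succ (m + 1), vsasm_succ m, csscpp_succ (m + 1)]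
  rw [cast_factorial_telescope (6 * (m + 1) + 3) (6 * m + 3) 6 (by ring),
    cast_factorial_telescope (6 * (m + 1)) (6 * m + 3) 3 (by ring),
    cast_factorial_telescope (2 * (m + 1) + 1) (2 * m + 1) 2 (by ring),
    cast_factorial_telescope (2 * (m + 1)) (2 * m + 1) 1 (by ring),
    cast_factorial_telescope (4 * (m + 1) + 2) (4 * m + 2) 4 (by ring),
    cast_factorial_telescope (4 * (m + 1) + 3) (4 * m + 2) 5 (by ring),
    cast_factorial_telescope (4 * (m + 1)) (4 * m + 2) 2 (by ring),
    cast_factorial_telescope (4 * (m + 1) + 1) (4 * m + 2) 3 (by ring),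
    cast_factorial_telescope (4 * m + 3) (4 * m + 2) 1 (by ring)]
  simp only [Finset.prod_range_succ, Finset.prod_range_zero]
  push_cast
  field_simp
  ring

/-- The polynomial inequality behind the monotonicity of `ipRatio m ^ 3 (m+1)`:
`N^3 (m+2) ≤ (m+1) D^3` for `m ≥ 0`, from the identity `D^3 (2m+2) = N^3 (2m+4) + Q(m)` with
`Q` a polynomial with non-negative coefficients. -/
private theorem ipRatio_step_poly (x : ℝ) (hx : 0 ≤ x) :
    ((3 * x + 5) * (6 * x + 7) * (4 * x + 3)) ^ 3 * (x + 2) ≤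
      (x + 1) * ((3 * x + 4) * (6 * x + 5) * (4 * x + 7)) ^ 3 := by
  have hQ : 0 ≤ 857500 + 5921650 * x + 17662470 * x ^ 2 + 29724116 * x ^ 3 + 30876084 * x ^ 4 +
      20276496 * x ^ 5 + 8223120 * x ^ 6 + 1883520 * x ^ 7 + 186624 * x ^ 8 := by positivity
  have key : ((3 * x + 4) * (6 * x + 5) * (4 * x + 7)) ^ 3 * (2 * x + 2) =
      ((3 * x + 5) * (6 * x + 7) * (4 * x + 3)) ^ 3 * (2 * x + 4) +
      (857500 + 5921650 * x + 17662470 * x ^ 2 + 29724116 * x ^ 3 + 30876084 * x ^ 4 +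
        20276496 * x ^ 5 + 8223120 * x ^ 6 + 1883520 * x ^ 7 + 186624 * x ^ 8) := by
    ring
  nlinarith [key, hQ]

/-- Monotonicity: `P_b(2m+3)^3 (m+2) ≤ P_b(2m+1)^3 (m+1)`. -/
private theorem ipRatio_cube_succ_le (m : ℕ) :
    ipRatio (m + 1) ^ 3 * ((m : ℝ) + 2) ≤ ipRatio m ^ 3 * ((m : ℝ) + 1) := by
  have h0 : 0 ≤ ipRatio m := ipRatio_nonneg m
  have hD : (0 : ℝ) < (3 * m + 4) * (6 * m + 5) * (4 * m + 7) := by positivity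
  rw [ipRatio_succ, mul_pow, div_pow, mul_assoc]
  refine mul_le_mul_of_nonneg_left ?_ (pow_nonneg h0 3)
  rw [div_mul_eq_mul_div, div_le_iff₀ (pow_pos hD 3)]
  exact ipRatio_step_poly m (Nat.cast_nonneg m)

/-- `P_b(2m+1)^3 (m+1) ≤ 1`. -/
private theorem ipRatio_cube_mul_le_one (m : ℕ) : ipRatio m ^ 3 * ((m : ℝ) + 1) ≤ 1 := by
  induction m with
  | zero => simp [ipRatio_zero]
  | succ m ih =>
    have := ipRatio_cube_succ_le m
    push_cast
    linarith

/-- **Stub `stub_ipAsymptotic`.** Ikhlef–Ponsaing's strip passage probability decays at least like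
`(2m+1)^{-1/3}`: `P_b(2m+1) ≤ 2 (2m+1)^{-1/3}`. -/
theorem stub_ipAsymptotic : ∃ C : ℝ, ∀ m : ℕ, ipRatio m ≤ C * (2 * (m : ℝ) + 1) ^ (-(1:ℝ) / 3) := by
  refine ⟨2, fun m => ?_⟩
  have h0 : 0 ≤ ipRatio m := ipRatio_nonneg m
  have ht : (0 : ℝ) < 2 * (m : ℝ) + 1 := by positivity
  have hg := ipRatio_cube_mul_le_one m
  have hpow : (2 * (2 * (m : ℝ) + 1) ^ (-(1:ℝ) / 3)) ^ 3 = 8 / (2 * (m : ℝ) + 1) := by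
    rw [mul_pow, ← Real.rpow_natCast ((2 * (m : ℝ) + 1) ^ (-(1:ℝ) / 3)) 3,
      ← Real.rpow_mul ht.le]
    norm_num [Real.rpow_neg_one, div_eq_mul_inv]
  refine le_of_pow_le_pow_left₀ (by norm_num : (3 : ℕ) ≠ 0) (by positivity) ?_
  rw [hpow, le_div_iff₀ ht]
  nlinarith [pow_nonneg h0 3]

end Summit.CriticalPhenomena.CardyFormulaZ2.Cruxes.EdgePrecompact.QkzStripBoundaryArm
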